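import Summits.BirchSwinnertonDyer.BirchSwinnertonDyer.Theorems.RamifiedSevenEllipticUnitsLemmaXiDeuringAssembly
import Literature.NumberTheory.QuadraticFields.UnitsModCubes
import HarnessLib

set_option linter.dupNamespace false
set_option autoImplicit false

/-!
# Lemma Ξ, kernel side (VIII): the O11 FRAME supplies the field-theoretic inputs — (P1) ∧ (P5) from
# Deuring's shape for an imaginary quadratic `K` with `d_K = −p`, `p ≥ 5`

Helper file for the K7r Value crux `EllipticUnitValueSevenOfGZK` (stmt-BirchSwinnertonDyer-19945), line
`rubin-formula-zp` v4/v4.1, stub `stub_rubinPackageSevenZp`, clauses (P1)/(P5). File (VII)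
(`…LemmaXiDeuringAssembly`) proves (P1) ∧ (P5) from Deuring's shape of `φ` given five field inputs:
`[K:ℚ] = 2`, `p ∣ d_K`, `𝒪_K^× = {±1}`, `θ ∈ 𝓞_K` with `θ² = −p`, and `\overline{σ'} = σ' ∘ c`. Here
all five are DERIVED from the O11 frame's data `IsImaginaryQuadratic K`, `NumberField.discr K = −p`,
`5 ≤ p` (for 𝒞₇: `K = ℚ(√−7)`, `discr K = cmFieldDiscrOfJ W.j = −7`, `X12.ClassCSeven`): the tree's
quadratic integral basis `TauData` (`s = 2τ − ε`, `s² = d_K`; units `±1` for `d_K < −4`,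
`TauData.units_eq_one_or_neg_one`) and Mathlib's `IsTotallyComplex` (no real embedding). RESULT:
`RubinPadicLFunctionData.ξ_eq_φac_and_norm_sq_of_frame` — inputs: the frame, `c ≠ 1`, an embedding
`σ' : K →+* ℂ`, and Deuring (ii) `IsHeckeConjEquivariant c φ` + (vi) «off a finite set: `φ` unramified
at `w`, `φ(ϖ_w) = σ'(α)`, `(α) = w`» (Silverman ATAEC II Thm. 9.2, Cor. 10.4.1 (a); cell typing ask W50).

References: Silverman, *Advanced Topics*, II Thm. 9.2, Cor. 10.4.1; Bhargava–Varma 2016 Lemma 13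
(units of imaginary quadratic orders); [BKNO] arXiv:2608.06879 Def. 4.2, 4.7.
-/

noncomputable section

open scoped Classical NNReal Topology Pointwise ComplexConjugate
open NumberField IsDedekindDomain Field
  Literature.NumberTheory.EllipticCurves
  Literature.NumberTheory.EllipticCurves.BurungaleKobayashiNakamuraOta2026
  Literature.NumberTheory.GaloisRepresentations
  Literature.NumberTheory.QuadraticFields

namespace Summit.BirchSwinnertonDyer.BirchSwinnertonDyer.Theorems.RamifiedSevenEllipticUnits

namespace LemmaXi

variable {K : Type} [Field K] [NumberField K] {p : ℕ} [hp : Fact p.Prime]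

omit hp in
/-- **The five field inputs from the frame**: for `K` imaginary quadratic with `d_K = −p`, `p ≥ 5`:
`[K:ℚ] = 2`, `p ∣ d_K`, `𝒪_K^× = {±1}`, `∃ θ ∈ 𝓞_K, θ² = −p` (`θ = 2τ − ε`), every embedding
`K → ℂ` is non-real, and `p ≠ 2`. [cite: BhargavaVarma2016, Lemma 13] -/
theorem frame_fieldInputs (hK : IsImaginaryQuadratic K) (hd : NumberField.discr K = -(p : ℤ))
    (hp5 : 5 ≤ p) :
    Module.finrank ℚ K = 2 ∧ ((p : ℤ) ∣ NumberField.discr K) ∧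
      (∀ u : (𝓞 K)ˣ, (u : 𝓞 K) = 1 ∨ (u : 𝓞 K) = -1) ∧
      (∃ θ : 𝓞 K, θ ^ 2 = -((p : ℕ) : 𝓞 K)) ∧
      (∀ σ' : K →+* ℂ, ¬ ComplexEmbedding.IsReal σ') ∧ p ≠ 2 := by
  obtain ⟨h2, htc⟩ := hK
  obtain ⟨T⟩ := Quadratic.nonempty_tauData (K := K) h2
  have hD : NumberField.discr K < -4 := by rw [hd]; omega
  refine ⟨h2, ⟨-1, by rw [hd]; ring⟩, fun u ↦ T.units_eq_one_or_neg_one h2 hD u, ⟨T.s, ?_⟩, ?_, by omega⟩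
  · rw [pow_two, T.s_mul_s]
    have h := T.discr_eq
    rw [hd] at h
    have h' : ((T.ε + 4 * T.m : ℤ) : 𝓞 K) = ((-(p : ℤ) : ℤ) : 𝓞 K) := by rw [← h]
    push_cast at h'
    linear_combination h'
  · intro σ' hreal
    have hc : (InfinitePlace.mk σ').IsComplex := htc.isComplex _
    rw [← InfinitePlace.not_isReal_iff_isComplex, InfinitePlace.isReal_mk_iff] at hc
    exact hc hreal

end LemmaXi

/-! ## (P1) ∧ (P5) in frame currency -/

section Datum

open LemmaXi

variable {W : WeierstrassCurve ℚ} [W.IsElliptic] {p : ℕ} [hp : Fact p.Prime]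
  {K : Type} [Field K] [NumberField K] {c : K ≃ₐ[ℚ] K} {𝔭 : HeightOneSpectrum (𝓞 K)}
  {κ : ZpExtension K p} {γ : absoluteGaloisGroup K} {ι : PadicAlgCl p ≃+* ℂ} {φ : HeckeCharacter K}
  {Ω : ℂ} {𝓔 : AcDualExpSystem W p K 𝔭 κ ι} {D : EllipticUnitClassData W p K 𝔭 κ γ ι φ Ω 𝓔}

/-- **(P1) ∧ (P5) from Deuring's shape, in O11-frame currency.** `K` imaginary quadratic with
`discr K = −p`, `p ≥ 5` prime, `𝔭 ∋ p`, `c ≠ 1` (the complex conjugation of `K`), `σ' : K → ℂ` any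
embedding; `φ` conjugation-equivariant (Deuring (ii)) and, off a finite set of places, unramified at `w`
with `φ(ϖ_w) = σ'(α_w)` for a generator `α_w` of `w` (Deuring (vi), Silverman II Cor. 10.4.1 (a)).
Then for EVERY `ℤ_p`-extension `κ`, topological generator `γ` and Rubin `p`-adic `L`-function datum `R`
over `φ`: `R.ξ = φ(φ∘c)⁻¹` (P1) and `‖avatarValueAt R.r γ − 1‖² = p⁻¹` (P5).
[cite: BurungaleKobayashiNakamuraOta2026, Def. 4.2 and Def. 4.7 (arXiv:2608.06879 pp. 24, 27) (claim; preprint; fields of the datum)]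
[cite: SilvermanATAEC1994, Ch. II Thm. 9.2 and Cor. 10.4.1 (a)] -/
theorem RubinPadicLFunctionData.ξ_eq_φac_and_norm_sq_of_frame [Fact (κ.IsTopGenerator γ)]
    (R : RubinPadicLFunctionData W p K c 𝔭 κ γ ι φ Ω 𝓔 D)
    (hK : IsImaginaryQuadratic K) (hd : NumberField.discr K = -(p : ℤ)) (hp5 : 5 ≤ p)
    (hp𝔭 : ((p : ℕ) : 𝓞 K) ∈ 𝔭.asIdeal) (hc : c ≠ 1) (σ' : K →+* ℂ)
    (heq : IsHeckeConjEquivariant c φ)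
    (hvals : ∃ S : Set (HeightOneSpectrum (𝓞 K)), S.Finite ∧ ∀ w ∉ S,
      φ.IsUnramifiedAt w ∧ ∃ α : 𝓞 K, Ideal.span {α} = w.asIdeal ∧ φ.valueAtUniformizer w = σ' (α : K)) :
    R.ξ = φ * (HeckeCharacter.galConj c φ)⁻¹ ∧ ‖avatarValueAt R.r γ - 1‖ ^ 2 = ((p : ℝ))⁻¹ := by
  obtain ⟨h2, hdvd, hunits, ⟨θ, hθ⟩, hnr, hp2⟩ := frame_fieldInputs (K := K) hK hd hp5
  exact RubinPadicLFunctionData.ξ_eq_φac_and_norm_sq_of_deuringShape R h2 hdvd hp𝔭 hp2 hc hunits hθ σ'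
    (conj_embedding_eq_embedding_algEquiv h2 c hc σ' (hnr σ')) heq hvals

end Datum

end Summit.BirchSwinnertonDyer.BirchSwinnertonDyer.Theorems.RamifiedSevenEllipticUnits

end
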